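import Literature.MathematicalPhysics.QuantumFieldTheory.Balaban1983to89.Beta.Assembly
import Summits.QuantumFields.BalabanUV.T4Continuum.Spine.NE4.EndpointFromNE4

/-!
# Spine/NE4/LimitFormFromNE4 — NE4 SUPPLIES THE β SUB-CELL's LIMIT FORM: given NE4 + the corner bound, the residual one-loop input of
# binder B3 (and of [Balaban1987RG1] Thm 2 as printed, up to the CAP sign list) is ONE SIGN — the sign of NE4's own limit `β⁰_∞ := lim β⁰_k`

Cell `pub-balaban-gaps` (YM blitz G2), seat `ne4`, generation 7 (unit `pub-balaban-gaps-ne4-g7`); record `HOME/ne/NE4.md` §5 census item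
(R38).  Sequel of `Spine/NE4/AsymptoticContent` (g4, (R31): NE4 for the full β ⟹ (AF-0r) with `β⁰_∞ = lim β⁰_k`, `c₀ = c∕(1−θ)`) and
`Spine/NE4/EndpointFromNE4` (g4: NE4 + corner bound + a one-loop FLOOR `b₀ ≤ β⁰_{k+1}` with `Cr·γ₀ ≤ b₀` ⟹ `DagBinding.EndpointExistence`).

THE POINT.  The β sub-cell of `pub-balaban` packages every residual flow-side hypothesis of the binder DAG in ONE structure,
`Beta.Assembly.LimitForm β` (Literature `…/Balaban1983to89/Beta/Assembly.lean` :129): the printed one-loop split `S`, a box `γ₀`, the limit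
coefficient `binf = β⁰_∞ > 0` (AF-0∞, row an3∕an5), the geometric rate `|β⁰_{k+1} − β⁰_∞| ≤ c₀θ^k` (AF-0r, rows an1∕an2 = GAPS G-an2-4), the
corner bound `|β¹_{k+1}(p)| ≤ Cr·p_k` (AF-1, row an4), joint continuity (C) and the PRINTED upper bound (U); and it derives from that structure
ALONE — shrinking the box to `γ₁ = min(γ₀, β⁰_∞∕(4(Cr+1)))` itself — the located consumers: `LimitForm.endpointExistence` (binder B3 of the T⁴
apex, [Balaban1987RG1] Thm 2's first sentence), `LimitForm.p355` ([Balaban1989LargeFieldII] p. 355), `LimitForm.thm2Printed_of_list` (Thm 2 AS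
PRINTED, given the finite CAP sign list `3β⁰_∞∕4 ≤ β⁰_{k+1}, k < k₁` past the threshold `c₀θ^{k₁} ≤ β⁰_∞∕4`), `LimitForm.tail_lower` (the
EVENTUAL FLOOR `β⁰_∞∕2 ≤ β_{k+1}` on `]0,γ₁]`-boxes, `k ≥ k₀`).  THIS FILE: under NE4 (`ScaleShiftRate c θ γ₀ β`, `0 ≤ θ < 1`) and the corner
bound, the fields `binf`, `c₀`, `θ`, `conv` are NOT inputs — `binf := limUnder atTop β⁰` IS the limit NE4 produces (`AsymptoticContent` §2 ∕
`EndpointFromNE4.tendsto_beta0_of_scaleShiftRate`), `c₀ := c∕(1−θ)` — so `LimitForm β` is CONSTRUCTED from {NE4, (AF-1), (C), (U)} plus ONE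
BIT, `0 < lim_k β⁰_k` (`limitFormOfNE4`, §2).  Consequences BY NAME (§3): B3 `DagBinding.EndpointExistence` from NE4 + corner + (C) + (U) + the
sign of the limit — NO floor constant `b₀`, NO `k₀`, NO box relation `Cr·γ₀ ≤ b₀` (g4's `endpointExistence_of_scaleShiftRate[_eventualFloor]`
asked all three; here the floor is an OUTPUT, `tail_lower_of_ne4`); [Balaban1987RG1] Thm 2 AS PRINTED from the same + the CAP sign list whose
LENGTH `k₀` and TEST `(c∕(1−θ))·θ^k ≤ β⁰_∞∕4` are now written in NE4's OWN constants (`thm2Printed_of_ne4_list`), and with NO list at all when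
NE4's constant is small against its own limit, `c∕(1−θ) ≤ β⁰_∞∕4` (`thm2Printed_of_ne4_small`); the same ON THE DATA `D : FiniteEpsData` (§4).
§1 records that the one bit has three equivalent spellings under NE4 + corner: `0 < limUnder atTop β⁰` ⟺ an EVENTUAL positive floor
`∃ b₀ > 0, ∃ k₀, ∀ k ≥ k₀, b₀ ≤ β⁰_{k+1}` ⟺ `Tendsto β⁰ atTop (𝓝 b)` for some `b > 0` (`limPos_iff_eventualFloor`, `limPos_of_tendsto`) — so
row an3's identification road (`β⁰_k → stepBal N L > 0`, `B12Normalization.stepBal`) discharges it by `limPos_of_tendsto`, and so would ANY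
eventual floor.

BOOKKEEPING CONSEQUENCE for the binder DAG (no status word moves): given the spine's NE4 and the corner bound (AF-1), the β sub-cell's rows
an1∕an2 ((AF-0r): rate AND constant) are INSIDE NE4 (g4), row an3∕an5's (AF-0∞) shrinks to the SIGN of one real number that NE4 defines, and
row CAP's list is indexed by NE4's constants `(c∕(1−θ), θ, lim β⁰)`; B3 ⇐ {NE4, (AF-1), (C), (U), sign}.  None of these inputs is printed except
(U)'s TYPE; none is this seat's to discharge.

WHAT THIS FILE IS NOT.  Not an estimate and not a discharge: NE4, (AF-1), (C), (U) and the sign are BINDERS; `limitFormOfNE4` is a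
CONSTRUCTOR of the sub-cell's hypothesis carrier from them, nothing of Bałaban's is asserted; 2 definitions (the constructor, β-generic and on
the data), the rest theorems.  HONEST FRAMING: NE4 NOT IN PRINT ∕ NOT PROVED (DEPENDENT = (R)∘{NE5} + (AF-0r)); B3 NOT discharged (0∕6 binders);
[Balaban1987RG1] Thm 2 UNPROVED in print and NOT proved here; spine 0∕9; one finite T⁴ — NOT continuum on ℝ⁴, NOT infinite volume, NOT a mass
gap, NOT Clay.  0 sorry; axioms standard; imports `Beta/Assembly` + `Spine/NE4/EndpointFromNE4`, modifies nothing.  Elementary, `[folklore]`.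

References (locators only): [Balaban1987RG1] = T. Bałaban, CMP **109** (1987) 249–301: (0.20) p. 256, Thm 2 + (0.31) p. 259, (2.12)–(2.14)
p. 268, §1 p. 264; [Balaban1989LargeFieldII] = CMP **122** (1989) 355–392, Thm 1 p. 355.
-/

noncomputable section

namespace Summit.QuantumFields.BalabanUV.T4Continuum.Spine.NE4

open Literature.MathematicalPhysics.QuantumFieldTheory.Balaban1983to89
open Literature.MathematicalPhysics.QuantumFieldTheory.Balaban1983to89.FlowStep
open Literature.MathematicalPhysics.QuantumFieldTheory.Balaban1983to89.T4CouplingMatching (ScaleShiftRate)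
open Literature.MathematicalPhysics.QuantumFieldTheory.Balaban1983to89.T4Continuum
open Literature.MathematicalPhysics.QuantumFieldTheory.Balaban1983to89.Beta.Assembly (LimitForm)
open Filter Topology

/-! ## §1 The one bit: `0 < lim β⁰_k`, and its equivalent spellings under NE4 + the corner bound -/

section OneBit

variable {β : HBeta} (S : B12Beta.OneLoopSplit β) {C c γ θ : ℝ}

/-- [bookkeeping] Under NE4 + the corner bound (`θ < 1`), `limUnder atTop β⁰` IS the limit of the one-loop coefficients:
`β⁰_k → limUnder atTop β⁰`, with the geometric rate `|β⁰_{k+1} − lim| ≤ (c∕(1−θ))θ^k`. [folklore] -/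
theorem tendsto_limUnder_of_scaleShiftRate (hγ : 0 < γ) (hθ1 : θ < 1)
    (hC : ∀ k (p : Fin (k + 1) → ℝ), p ∈ Box γ k → |S.β1 k p| ≤ C * p (Fin.last k)) (h : ScaleShiftRate c θ γ β) :
    Tendsto S.β0 atTop (𝓝 (limUnder atTop S.β0)) ∧ ∀ k, |S.β0 k - limUnder atTop S.β0| ≤ c / (1 - θ) * θ ^ k := by
  obtain ⟨b, hb, hrate⟩ := tendsto_beta0_of_scaleShiftRate S hγ hθ1 hC h
  have e : limUnder atTop S.β0 = b := hb.limUnder_eq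
  rw [e]
  exact ⟨hb, hrate⟩

/-- [bookkeeping] If the one-loop coefficients converge to SOME `b` (e.g. row an3's identification road, `b = stepBal N L`), then
`limUnder atTop β⁰ = b`; in particular `0 < b` gives the one bit `0 < limUnder atTop β⁰`. [folklore] -/
theorem limPos_of_tendsto {b : ℝ} (hb : Tendsto S.β0 atTop (𝓝 b)) (hpos : 0 < b) : 0 < limUnder atTop S.β0 := by
  rw [hb.limUnder_eq]; exact hpos

/-- **THE ONE BIT ⟺ AN EVENTUAL POSITIVE FLOOR.**  Under NE4 + the corner bound: `0 < limUnder atTop β⁰` iff there are `b₀ > 0` and `k₀`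
with `b₀ ≤ β⁰_{k+1}` for all `k ≥ k₀` (shape (AF-0∞) as an eventual floor — NO small-k signs).  (⇒: the tail sits above half the limit;
⇐: `EndpointFromNE4.floor_le_binf_eventually`.) [folklore] -/
theorem limPos_iff_eventualFloor (hγ : 0 < γ) (hθ1 : θ < 1)
    (hC : ∀ k (p : Fin (k + 1) → ℝ), p ∈ Box γ k → |S.β1 k p| ≤ C * p (Fin.last k)) (h : ScaleShiftRate c θ γ β) :
    0 < limUnder atTop S.β0 ↔ ∃ b₀ : ℝ, 0 < b₀ ∧ ∃ k₀ : ℕ, ∀ k, k₀ ≤ k → b₀ ≤ S.β0 k := by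
  obtain ⟨hlim, -⟩ := tendsto_limUnder_of_scaleShiftRate S hγ hθ1 hC h
  set b := limUnder atTop S.β0 with hb
  constructor
  · intro hpos
    have hev : ∀ᶠ k in atTop, b / 2 < S.β0 k := hlim.eventually (lt_mem_nhds (by linarith))
    obtain ⟨k₀, hk₀⟩ := Filter.eventually_atTop.mp hev
    exact ⟨b / 2, by linarith, k₀, fun k hk => (hk₀ k hk).le⟩
  · rintro ⟨b₀, hb₀, k₀, hfloor⟩
    exact hb₀.trans_le (floor_le_binf_eventually S hlim hfloor)

end OneBit

/-! ## §2 The constructor: `LimitForm β` from NE4 + (AF-1) + (C) + (U) + the one bit -/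

section Constructor

variable {β : HBeta}

/-- **NE4 SUPPLIES THE LIMIT FORM.**  From the printed one-loop split `S`, NE4 for the full β on `]0,γ₀]` (`ScaleShiftRate c θ γ₀ β`,
`0 ≤ θ < 1`), the corner bound (AF-1) `|β¹_{k+1}(p)| ≤ Cr·p_k`, joint continuity (C), the printed-type upper bound (U), and ONE BIT — the sign
of NE4's own limit, `0 < limUnder atTop β⁰` —, the β sub-cell's hypothesis carrier `Beta.Assembly.LimitForm β` with `binf := lim β⁰_k`,
`c₀ := c∕(1−θ)` and the rate field `conv` DISCHARGED by `AsymptoticContent` §2.  A constructor of a HYPOTHESIS CARRIER from hypotheses;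
nothing of Bałaban's asserted. [folklore] -/
def limitFormOfNE4 (S : B12Beta.OneLoopSplit β) {c θ γ₀ Cr β' : ℝ} (hγ₀ : 0 < γ₀) (hθ0 : 0 ≤ θ) (hθ1 : θ < 1)
    (h : ScaleShiftRate c θ γ₀ β) (hAF1 : ∀ k (p : Fin (k + 1) → ℝ), p ∈ Box γ₀ k → |S.β1 k p| ≤ Cr * p (Fin.last k))
    (hCr : 0 ≤ Cr) (hpos : 0 < limUnder atTop S.β0) (hcont : BetaContH γ₀ β) (hup : BetaUpperH β' γ₀ β) : LimitForm β where
  S := S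
  γ₀ := γ₀
  γ₀_pos := hγ₀
  binf := limUnder atTop S.β0
  binf_pos := hpos
  c₀ := c / (1 - θ)
  c₀_nonneg := div_nonneg (scaleShiftRate_const_nonneg h hγ₀) (by linarith)
  θ := θ
  θ_nonneg := hθ0
  θ_lt_one := hθ1
  conv := (tendsto_limUnder_of_scaleShiftRate S hγ₀ hθ1 hAF1 h).2
  Cr := Cr
  Cr_nonneg := hCr
  af1 := fun k p hp => hAF1 k p (mem_box.mpr hp)
  cont := hcont
  β' := β'
  upper := hup

variable (S : B12Beta.OneLoopSplit β) {c θ γ₀ Cr β' : ℝ} (hγ₀ : 0 < γ₀) (hθ0 : 0 ≤ θ) (hθ1 : θ < 1)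
  (h : ScaleShiftRate c θ γ₀ β) (hAF1 : ∀ k (p : Fin (k + 1) → ℝ), p ∈ Box γ₀ k → |S.β1 k p| ≤ Cr * p (Fin.last k))
  (hCr : 0 ≤ Cr) (hpos : 0 < limUnder atTop S.β0) (hcont : BetaContH γ₀ β) (hup : BetaUpperH β' γ₀ β)

/-- [bookkeeping] The constructed form's limit coefficient is NE4's limit. [folklore] -/
@[simp] theorem limitFormOfNE4_binf : (limitFormOfNE4 S hγ₀ hθ0 hθ1 h hAF1 hCr hpos hcont hup).binf = limUnder atTop S.β0 := rfl

/-- [bookkeeping] The constructed form's rate constant is `c∕(1−θ)` (NE4's constant summed geometrically). [folklore] -/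
@[simp] theorem limitFormOfNE4_c₀ : (limitFormOfNE4 S hγ₀ hθ0 hθ1 h hAF1 hCr hpos hcont hup).c₀ = c / (1 - θ) := rfl

/-- [bookkeeping] The constructed form's rate is NE4's rate `θ`. [folklore] -/
@[simp] theorem limitFormOfNE4_θ : (limitFormOfNE4 S hγ₀ hθ0 hθ1 h hAF1 hCr hpos hcont hup).θ = θ := rfl

end Constructor

/-! ## §3 Consequences BY NAME through `Beta.Assembly`: B3, the eventual floor as an OUTPUT, Thm 2 as printed given the CAP list -/

section Consumers

variable {β : HBeta} (S : B12Beta.OneLoopSplit β) {c θ γ₀ Cr β' : ℝ}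

/-- **B3 FROM NE4 + ONE SIGN.**  For a forward-generated construction ([Balaban1987RG1] (0.20)): NE4 for the full β + the corner bound (AF-1) +
continuity (C) + the printed-type upper bound (U) + `0 < lim β⁰_k` ⟹ `DagBinding.EndpointExistence C` ([Balaban1987RG1] Thm 2's first
sentence; binder `hEnd` of `T4ContinuumYM4Torus.continuumYM4_torus_of_endpointExistence`).  Compared with g4's
`endpointExistence_of_scaleShiftRate_eventualFloor`: NO floor constant, NO scale `k₀`, NO box relation `Cr·γ₀ ≤ b₀` — the box is shrunk inside
`LimitForm.endpointExistence`. [cite: Balaban1987RG1, Thm 2 p.259 and (0.20) p.256] -/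
theorem endpointExistence_of_ne4_limPos {C : B12.Construction} (hgen : DagBinding.ForwardGenerated C β) (hγ₀ : 0 < γ₀)
    (hθ0 : 0 ≤ θ) (hθ1 : θ < 1) (h : ScaleShiftRate c θ γ₀ β)
    (hAF1 : ∀ k (p : Fin (k + 1) → ℝ), p ∈ Box γ₀ k → |S.β1 k p| ≤ Cr * p (Fin.last k)) (hCr : 0 ≤ Cr)
    (hpos : 0 < limUnder atTop S.β0) (hcont : BetaContH γ₀ β) (hup : BetaUpperH β' γ₀ β) :
    DagBinding.EndpointExistence C :=
  (limitFormOfNE4 S hγ₀ hθ0 hθ1 h hAF1 hCr hpos hcont hup).endpointExistence hgen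

/-- **B3 FROM NE4 + CONVERGENCE TO A POSITIVE NUMBER** (the form row an3's identification road delivers: `β⁰_k → b`, `0 < b`).
[cite: Balaban1987RG1, Thm 2 p.259 and (0.20) p.256] -/
theorem endpointExistence_of_ne4_tendsto {C : B12.Construction} (hgen : DagBinding.ForwardGenerated C β) (hγ₀ : 0 < γ₀)
    (hθ0 : 0 ≤ θ) (hθ1 : θ < 1) (h : ScaleShiftRate c θ γ₀ β)
    (hAF1 : ∀ k (p : Fin (k + 1) → ℝ), p ∈ Box γ₀ k → |S.β1 k p| ≤ Cr * p (Fin.last k)) (hCr : 0 ≤ Cr)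
    {b : ℝ} (hb : Tendsto S.β0 atTop (𝓝 b)) (hbpos : 0 < b) (hcont : BetaContH γ₀ β) (hup : BetaUpperH β' γ₀ β) :
    DagBinding.EndpointExistence C :=
  endpointExistence_of_ne4_limPos S hgen hγ₀ hθ0 hθ1 h hAF1 hCr (limPos_of_tendsto S hb hbpos) hcont hup

/-- **THE EVENTUAL FLOOR IS AN OUTPUT.**  Under NE4 + corner + (C) + (U) + the one bit, the FULL β-functions sit above half the limit on the
shrunk boxes from the threshold on: `∀ k ≥ k₀, ∀ v ∈ ]0,γ₁]^{k+1}, (lim β⁰)∕2 ≤ β_{k+1}(v)`, with `γ₁`, `k₀` the sub-cell's constants of the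
constructed form (`LimitForm.γ₁`, `LimitForm.k₀`, written in `c∕(1−θ)`, `θ`, `lim β⁰`, `Cr`) — what g4's theorems took as the INPUT `hfloor`.
[folklore] -/
theorem tail_lower_of_ne4 (hγ₀ : 0 < γ₀) (hθ0 : 0 ≤ θ) (hθ1 : θ < 1) (h : ScaleShiftRate c θ γ₀ β)
    (hAF1 : ∀ k (p : Fin (k + 1) → ℝ), p ∈ Box γ₀ k → |S.β1 k p| ≤ Cr * p (Fin.last k)) (hCr : 0 ≤ Cr)
    (hpos : 0 < limUnder atTop S.β0) (hcont : BetaContH γ₀ β) (hup : BetaUpperH β' γ₀ β) :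
    ∀ k, (limitFormOfNE4 S hγ₀ hθ0 hθ1 h hAF1 hCr hpos hcont hup).k₀ ≤ k →
      ∀ v ∈ Box (limitFormOfNE4 S hγ₀ hθ0 hθ1 h hAF1 hCr hpos hcont hup).γ₁ k, limUnder atTop S.β0 / 2 ≤ β k v :=
  (limitFormOfNE4 S hγ₀ hθ0 hθ1 h hAF1 hCr hpos hcont hup).tail_lower

/-- **[Balaban1987RG1] THEOREM 2 AS PRINTED FROM NE4 + ONE SIGN + THE CAP LIST IN NE4's CONSTANTS.**  For a forward-generated construction
and `L > 1`: NE4 + corner + (C) + (U) + `0 < lim β⁰` + the finite sign list `3(lim β⁰)∕4 ≤ β⁰_{k+1}` for `k < k₁`, ANY `k₁` past the threshold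
`(c∕(1−θ))·θ^{k₁} ≤ (lim β⁰)∕4` ⟹ `B12.Thm2Printed C L` (bare couplings by (0.20) AND the two-sided (0.31) for all `k ≤ K`).  The list's
length and test are row CAP's, here indexed by NE4's own `(c∕(1−θ), θ, lim β⁰)`; the sharp list is `{k ∣ lim β⁰ ≤ (c∕(1−θ))θ^k}`
(`Gaps/CapSignListLength.capSet_exact`, not used here).  Thm 2 is UNPROVED in print; every input is a binder. [cite: Balaban1987RG1, Thm 2 p.259 with (0.31)] -/
theorem thm2Printed_of_ne4_list {C : B12.Construction} (hgen : DagBinding.ForwardGenerated C β) {L : ℝ} (hL : 1 < L)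
    (hγ₀ : 0 < γ₀) (hθ0 : 0 ≤ θ) (hθ1 : θ < 1) (h : ScaleShiftRate c θ γ₀ β)
    (hAF1 : ∀ k (p : Fin (k + 1) → ℝ), p ∈ Box γ₀ k → |S.β1 k p| ≤ Cr * p (Fin.last k)) (hCr : 0 ≤ Cr)
    (hpos : 0 < limUnder atTop S.β0) (hcont : BetaContH γ₀ β) (hup : BetaUpperH β' γ₀ β) {k₁ : ℕ}
    (hk₁ : c / (1 - θ) * θ ^ k₁ ≤ limUnder atTop S.β0 / 4)
    (hsmall : ∀ k, k < k₁ → 3 * limUnder atTop S.β0 / 4 ≤ S.β0 k) : B12.Thm2Printed C L :=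
  (limitFormOfNE4 S hγ₀ hθ0 hθ1 h hAF1 hCr hpos hcont hup).thm2Printed_of_list hgen hL hk₁ hsmall

/-- **THEOREM 2 AS PRINTED WITH NO SIGN LIST, WHEN NE4's CONSTANT IS SMALL AGAINST ITS OWN LIMIT**: `c∕(1−θ) ≤ (lim β⁰)∕4` (then the
threshold is `k₁ = 0`).  At `(N, L) = (2, 2)` the β numerics desk's floats (`NUMERICS-BETA.md` §5c: `β⁰₁ − stepBal = +0.372 > stepBal = 0.2575`)
say this premise FAILS for Bałaban's one-loop sequence if `lim β⁰ = stepBal` — recorded in NE4.md (R38), float-only; the theorem is about the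
shapes. [cite: Balaban1987RG1, Thm 2 p.259 with (0.31)] -/
theorem thm2Printed_of_ne4_small {C : B12.Construction} (hgen : DagBinding.ForwardGenerated C β) {L : ℝ} (hL : 1 < L)
    (hγ₀ : 0 < γ₀) (hθ0 : 0 ≤ θ) (hθ1 : θ < 1) (h : ScaleShiftRate c θ γ₀ β)
    (hAF1 : ∀ k (p : Fin (k + 1) → ℝ), p ∈ Box γ₀ k → |S.β1 k p| ≤ Cr * p (Fin.last k)) (hCr : 0 ≤ Cr)
    (hpos : 0 < limUnder atTop S.β0) (hcont : BetaContH γ₀ β) (hup : BetaUpperH β' γ₀ β)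
    (hc : c / (1 - θ) ≤ limUnder atTop S.β0 / 4) : B12.Thm2Printed C L :=
  thm2Printed_of_ne4_list S hgen hL hγ₀ hθ0 hθ1 h hAF1 hCr hpos hcont hup (k₁ := 0) (by simpa using hc)
    fun k hk => absurd hk (Nat.not_lt_zero k)

end Consumers

/-! ## §4 The same ON THE DATA -/

section Data

universe u

variable {F : T4Family} {G : Type u} [GaugeGroup G] [MeasurableSpace G] [HaarData G]

/-- [face] **ON THE DATA: NE4 SUPPLIES THE LIMIT FORM OF `D.βfun`.**  `NE4OnData D c θ γ₀` + the corner bound + (C) + (U) + the one bit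
`0 < lim β⁰` ⟹ `Beta.Assembly.LimitForm D.βfun` (constructor; nothing asserted). [folklore] -/
def limitFormOfNE4OnData (D : FiniteEpsData F G) (S : B12Beta.OneLoopSplit D.βfun) {c θ γ₀ Cr β' : ℝ} (hγ₀ : 0 < γ₀)
    (hθ0 : 0 ≤ θ) (hθ1 : θ < 1) (h : NE4OnData D c θ γ₀)
    (hAF1 : ∀ k (p : Fin (k + 1) → ℝ), p ∈ Box γ₀ k → |S.β1 k p| ≤ Cr * p (Fin.last k)) (hCr : 0 ≤ Cr)
    (hpos : 0 < limUnder atTop S.β0) (hcont : BetaContH γ₀ D.βfun) (hup : BetaUpperH β' γ₀ D.βfun) : LimitForm D.βfun :=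
  limitFormOfNE4 S hγ₀ hθ0 hθ1 h hAF1 hCr hpos hcont hup

/-- [face] **ON THE DATA: B3 FROM NE4 + ONE SIGN** — `NE4OnData D c θ γ₀` + corner bound + (C) + (U) + `0 < lim β⁰` ⟹
`DagBinding.EndpointExistence D.C.toB12`, the apex's `hEnd` (forward generation is the field `D.fwd`); no floor data. [folklore] -/
theorem endpointExistence_of_ne4OnData_limPos (D : FiniteEpsData F G) (S : B12Beta.OneLoopSplit D.βfun) {c θ γ₀ Cr β' : ℝ}
    (hγ₀ : 0 < γ₀) (hθ0 : 0 ≤ θ) (hθ1 : θ < 1) (h : NE4OnData D c θ γ₀)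
    (hAF1 : ∀ k (p : Fin (k + 1) → ℝ), p ∈ Box γ₀ k → |S.β1 k p| ≤ Cr * p (Fin.last k)) (hCr : 0 ≤ Cr)
    (hpos : 0 < limUnder atTop S.β0) (hcont : BetaContH γ₀ D.βfun) (hup : BetaUpperH β' γ₀ D.βfun) :
    DagBinding.EndpointExistence D.C.toB12 :=
  endpointExistence_of_ne4_limPos S D.fwd hγ₀ hθ0 hθ1 h hAF1 hCr hpos hcont hup

/-- [face] **ON THE DATA: [Balaban1987RG1] Thm 2 AS PRINTED for Bałaban's construction `D.C.toB12` from NE4 for the data + one sign + the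
CAP list in NE4's constants** (`L > 1`).  Thm 2 UNPROVED in print; every input a binder. [cite: Balaban1987RG1, Thm 2 p.259 with (0.31)] -/
theorem thm2Printed_of_ne4OnData_list (D : FiniteEpsData F G) (S : B12Beta.OneLoopSplit D.βfun) {c θ γ₀ Cr β' L : ℝ}
    (hL : 1 < L) (hγ₀ : 0 < γ₀) (hθ0 : 0 ≤ θ) (hθ1 : θ < 1) (h : NE4OnData D c θ γ₀)
    (hAF1 : ∀ k (p : Fin (k + 1) → ℝ), p ∈ Box γ₀ k → |S.β1 k p| ≤ Cr * p (Fin.last k)) (hCr : 0 ≤ Cr)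
    (hpos : 0 < limUnder atTop S.β0) (hcont : BetaContH γ₀ D.βfun) (hup : BetaUpperH β' γ₀ D.βfun) {k₁ : ℕ}
    (hk₁ : c / (1 - θ) * θ ^ k₁ ≤ limUnder atTop S.β0 / 4)
    (hsmall : ∀ k, k < k₁ → 3 * limUnder atTop S.β0 / 4 ≤ S.β0 k) : B12.Thm2Printed D.C.toB12 L :=
  thm2Printed_of_ne4_list S D.fwd hL hγ₀ hθ0 hθ1 h hAF1 hCr hpos hcont hup hk₁ hsmall

end Data

end Summit.QuantumFields.BalabanUV.T4Continuum.Spine.NE4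

end
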